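import Literature.NumberTheory.QuadraticFields.KroneckerCharacterFourProofs
import Literature.NumberTheory.QuadraticFields.QuadraticDedekindZetaKronecker
import Literature.NumberTheory.QuadraticFields.FundamentalDiscriminant
import HarnessLib

/-!
# The Kronecker character of a quadratic field with even discriminant `d_K = 4m`:
# values `(d_K/n)`, parity `χ(−1) = sign d_K`, primitivity, and `ζ_K = ζ · L(·, χ_{d_K})` — PROVED

Topic `Literature/NumberTheory/QuadraticFields`; namespaces `Literature.NumberTheory.QuadraticFields`
(continuing `KroneckerCharacterFourProofs.lean`: the character mod `4|m|` with values `(m/n)` at odd `n`)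
and `….Quadratic` (quadratic fields).  Everything here is PROVED (theorems only; no definitions, no named
facts; standard axioms).

The tree treats the ODD discriminants through the Jacobi character `jacobiChar |d_K| = (·/|d_K|)`
(`QuadraticDedekindZeta.lean`: `ζ_K = ζ · L(·, (·/|d_K|))`, Dirichlet's class number formula) and, for
even `d_K = 4m`, has the character mod `4|m|` (`exists_dirichletCharacter_four_mul`, primitive by
`isPrimitive_of_forall_odd`, odd for `m < 0` by `apply_neg_one_of_forall_odd`) and the factorisation
`dedekindZeta_eq_riemannZeta_mul_LSeries_of_kronecker`.  This file adds the two facts needed to use the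
even-discriminant character in the certified class-number formulas (Booker 2006 (7), Cohen Prop. 5.3.14 /
5.6.11 — `Literature/NumberTheory/LFunctions/Certified*`):

* `apply_neg_one_of_forall_odd_of_pos` — **parity for `m > 0`**: the character is EVEN, `χ(−1) = 1`
  (`χ(−1) = χ(4m − 1) = (m / 4m−1) = 1` by reciprocity, as in the `m < 0` computation of the companion file);
* `apply_natCast_eq_jacobiSym_four_mul` — **values at every `n ≥ 1`: `χ(n) = (4m/n)`**, where for EVEN top
  argument Mathlib's `jacobiSym (4m) n` (which carries the factor `legendreSym 2 (4m) = 0` at each `2 ∣ n`) is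
  literally the Kronecker symbol `(d_K/n)`: `= (m/n)` at odd `n`, `= 0` at even `n`;
* `Quadratic.exists_kroneckerChar_of_four_dvd` — for a quadratic field `K` with `4 ∣ d_K`: a PRIMITIVE QUADRATIC
  Dirichlet character `κ ≠ 1` mod `|d_K|` with `κ(n) = (d_K/n)` for all `n ≥ 1`, EVEN if `d_K > 0` and ODD if
  `d_K < 0`, and `ζ_K(s) = ζ(s) L(s, κ)` for `Re s > 1`.

Classical source: the real primitive characters are the Kronecker symbols `(D/·)` of the fundamental
discriminants `D`, with `χ_D(−1) = sign D` (Montgomery–Vaughan, *Multiplicative Number Theory I*, §9.3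
Theorem 9.13; Davenport, *Multiplicative Number Theory*, Ch. 5), and `ζ_K(s) = ζ(s) L(s, χ_{d_K})`
(Montgomery–Vaughan §10.1 Exercise 26; Cox, *Primes of the form x² + ny²*, §1.C Lemma 1.14 for the
character mod `4|m|`). [cite: MontgomeryVaughan2007, §9.3 Theorem 9.13; §10.1 Exercise 26]
[cite: Cox2013, §1.C Lemma 1.14]
-/

noncomputable section

open scoped NumberTheorySymbols

namespace Literature.NumberTheory.QuadraticFields

/-! ### The character mod `4|m|`: parity for `m > 0`, values at all `n ≥ 1` -/

section Character

variable {m : ℤ} {χ : DirichletCharacter ℂ (4 * m.natAbs)}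

/-- **`χ(−1) = 1` for `m > 0`** with `m ≡ 2, 3 (mod 4)`: the Kronecker character of a real quadratic field of
even discriminant `4m` is even.  Computation: `χ(−1) = χ(4m − 1) = (m / 4m−1) = 1` (reciprocity; for
`m = 2m₀`, `(2 / 4m−1) = χ₈(8m₀ − 1) = 1`). [cite: MontgomeryVaughan2007, §9.3 Theorem 9.13 («χ(−1) = 1 if and
only if d > 0»)] -/
theorem apply_neg_one_of_forall_odd_of_pos (hm : 0 < m) (hm4 : m % 4 = 2 ∨ m % 4 = 3)
    (hχ : ∀ n : ℕ, Odd n → χ n = (J(m | n) : ℂ)) : χ (-1) = 1 := by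
  set n := m.natAbs with hn
  have hmn : m = (n : ℤ) := by omega
  have hn0 : 0 < n := by omega
  haveI : NeZero (4 * n) := ⟨by omega⟩
  have hcast : ((4 * n - 1 : ℕ) : ZMod (4 * n)) = -1 := by
    rw [Nat.cast_sub (by omega), Nat.cast_one, ZMod.natCast_self, zero_sub]
  have hodd : Odd (4 * n - 1) := Nat.odd_iff.mpr (by omega)
  have hb4 : (4 * n - 1) % 4 = 3 := by omega
  rw [← hcast, hχ _ hodd, hmn]
  suffices h : J((n : ℤ) | 4 * n - 1) = 1 by rw [h, Int.cast_one]
  rcases hm4 with h4 | h4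
  · -- `m ≡ 2 (mod 4)`: `n = 2 n₀` with `n₀` odd, `4n − 1 ≡ 7 (mod 8)`
    obtain ⟨n₀, hn₀⟩ : 2 ∣ n := by omega
    have hn₀odd : Odd n₀ := Nat.odd_iff.mpr (by omega)
    rw [show (n : ℤ) = 2 * (n₀ : ℤ) by rw [hn₀]; push_cast; ring, jacobiSym.mul_left,
      jacobiSym.at_two hodd, (χ₈_nat_of_mod_eight (b := 4 * n - 1)).1 (by omega), one_mul]
    refine jacobiSym_eq_one_of_mod_four_eq_three_of_emod_eq_neg_one hn₀odd hb4 ?_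
    rw [Nat.cast_sub (by omega)]
    push_cast
    rw [show (4 : ℤ) * (n : ℤ) - 1 = -1 + (n₀ : ℤ) * 8 by rw [hn₀]; push_cast; ring,
      Int.add_mul_emod_self_left]
  · -- `m ≡ 3 (mod 4)`: `n` odd
    have hnodd : Odd n := Nat.odd_iff.mpr (by omega)
    refine jacobiSym_eq_one_of_mod_four_eq_three_of_emod_eq_neg_one hnodd hb4 ?_
    rw [Nat.cast_sub (by omega)]
    push_cast
    rw [show (4 : ℤ) * (n : ℤ) - 1 = -1 + (n : ℤ) * 4 by ring, Int.add_mul_emod_self_left]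

/-- **Values at every `n ≥ 1`: `χ(n) = (4m/n)`.**  At odd `n`, `(4m/n) = (4/n)(m/n) = (m/n) = χ(n)`; at even
`n ≥ 2` both sides vanish (`χ` is `0` off the units mod `4|m|`; Mathlib's `jacobiSym (4m) n` contains the
factor `legendreSym 2 (4m) = 0`, equivalently `gcd(4m, n) ≠ 1`).  Thus for an even fundamental discriminant
`D = 4m`, `n ↦ jacobiSym D n` (`n ≥ 1`) is the Kronecker symbol `(D/n)`. [cite: MontgomeryVaughan2007, §9.3
Theorem 9.13; Cox2013, §1.C Lemma 1.14 and (1.18)] -/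
theorem apply_natCast_eq_jacobiSym_four_mul (hm0 : m ≠ 0)
    (hχ : ∀ n : ℕ, Odd n → χ n = (J(m | n) : ℂ)) {n : ℕ} (hn : n ≠ 0) :
    χ n = (J(4 * m | n) : ℂ) := by
  haveI : NeZero (4 * m.natAbs) := ⟨mul_ne_zero (by norm_num) (Int.natAbs_ne_zero.mpr hm0)⟩
  rcases Nat.even_or_odd n with he | ho
  · -- even `n`: both sides vanish
    have hval : Even ((n : ZMod (4 * m.natAbs)).val) := by
      rw [Nat.even_iff, ZMod.val_natCast, Nat.mod_mod_of_dvd n ⟨2 * m.natAbs, by ring⟩]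
      exact Nat.even_iff.mp he
    have h2a : (2 : ℤ) ∣ 4 * m := ⟨2 * m, by ring⟩
    have h2b : (2 : ℤ) ∣ (n : ℤ) := by exact_mod_cast even_iff_two_dvd.mp he
    have hg := Int.dvd_gcd h2a h2b
    have hne : (4 * m).gcd n ≠ 1 := fun h => by
      rw [h] at hg
      norm_num at hg
    rw [apply_eq_zero_of_even hval, jacobiSym.eq_zero_iff.mpr ⟨hn, hne⟩, Int.cast_zero]
  · have hgcd : (2 : ℤ).gcd n = 1 := by
      rw [show (2 : ℤ) = ((2 : ℕ) : ℤ) from rfl, Int.gcd_natCast_natCast]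
      exact Nat.coprime_two_left.mpr ho
    rw [hχ n ho, jacobiSym.mul_left, show (4 : ℤ) = 2 ^ 2 by norm_num, jacobiSym.sq_one' hgcd, one_mul]

end Character

/-! ### Quadratic fields with `4 ∣ d_K` -/

namespace Quadratic

open Module

variable {K : Type*} [Field K] [NumberField K]

/-- **The Kronecker character of a quadratic field with even discriminant.**  For `[K : ℚ] = 2` with
`4 ∣ d_K` (so `d_K = 4m`, `m ≡ 2, 3 (mod 4)` square-free): there is a primitive quadratic Dirichlet character
`κ ≠ 1` mod `|d_K|` with `κ(n) = (d_K/n)` for every `n ≥ 1` (Kronecker symbol; see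
`apply_natCast_eq_jacobiSym_four_mul`), EVEN if `d_K > 0` and ODD if `d_K < 0`, and
`ζ_K(s) = ζ(s) L(s, κ)` for `Re s > 1`.  (The odd-discriminant counterpart is the Jacobi character
`jacobiChar |d_K|` of `QuadraticDedekindZeta.lean`.) [cite: MontgomeryVaughan2007, §9.3 Theorem 9.13; §10.1
Exercise 26] [cite: Cox2013, §1.C Lemma 1.14] -/
theorem exists_kroneckerChar_of_four_dvd (h2 : finrank ℚ K = 2) (h4 : 4 ∣ NumberField.discr K) :
    ∃ κ : DirichletCharacter ℂ (NumberField.discr K).natAbs,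
      κ.IsPrimitive ∧ κ.IsQuadratic ∧ κ ≠ 1 ∧
      (∀ n : ℕ, n ≠ 0 → κ n = (J(NumberField.discr K | n) : ℂ)) ∧
      (0 < NumberField.discr K → κ.Even) ∧ (NumberField.discr K < 0 → κ.Odd) ∧
      ∀ s : ℂ, 1 < s.re →
        NumberField.dedekindZeta K s = riemannZeta s * LSeries (fun n => κ n) s := by
  have hm4 := discr_div_four_emod_four h2 h4
  have hsq : Squarefree (NumberField.discr K / 4) := by
    rcases isFundamentalDiscriminant_discr (K := K) h2 with ⟨h1, -, -⟩ | ⟨-, -, hsq⟩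
    · exfalso; omega
    · exact hsq
  obtain ⟨m, hm⟩ := h4
  have hDm : NumberField.discr K / 4 = m := by omega
  rw [hDm] at hm4 hsq
  have hm0 : m ≠ 0 := hsq.ne_zero
  have hd : (NumberField.discr K).natAbs = 4 * m.natAbs := by rw [hm, Int.natAbs_mul]; rfl
  rw [hd]
  haveI : NeZero (4 * m.natAbs) := ⟨mul_ne_zero (by norm_num) (Int.natAbs_ne_zero.mpr hm0)⟩
  obtain ⟨κ, hκ⟩ := exists_dirichletCharacter_four_mul m hm0
  have hprim : κ.IsPrimitive := isPrimitive_of_forall_odd hm4 hsq hκ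
  have hne : κ ≠ 1 := by
    intro h
    have hc : κ.conductor = 4 * m.natAbs := hprim
    rw [h, DirichletCharacter.conductor_one] at hc
    have := Int.natAbs_pos.mpr hm0
    omega
  refine ⟨κ, hprim, isQuadratic_of_forall_odd hm0 hκ, hne, fun n hn => ?_, fun hpos => ?_, fun hneg => ?_,
    fun s hs => ?_⟩
  · rw [hm]
    exact apply_natCast_eq_jacobiSym_four_mul hm0 hκ hn
  · exact apply_neg_one_of_forall_odd_of_pos (by omega) hm4 hκ
  · exact apply_neg_one_of_forall_odd (by omega) hm4 hκ
  · refine dedekindZeta_eq_riemannZeta_mul_LSeries_of_kronecker h2 κ (fun p hp hp2 => ?_) ?_ hs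
    · -- odd primes: `κ(p) = (m/p) = (4m/p) = (d/p)`
      have hpodd : Odd p := hp.odd_of_ne_two hp2
      rw [hκ p hpodd, hm, jacobiSym.mul_left]
      have h4 : J(4 | p) = 1 := by
        rw [show (4 : ℤ) = 2 ^ 2 by norm_num]
        exact jacobiSym.sq_one' (by
          rw [show (2 : ℤ) = ((2 : ℕ) : ℤ) by rfl, Int.gcd_natCast_natCast]
          exact (Nat.coprime_primes Nat.prime_two hp).mpr (Ne.symm hp2))
      rw [h4, one_mul]
    · -- the prime `2`: `κ(2) = 0` and `d ≡ 0, 4 (mod 8)`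
      have h81 : NumberField.discr K % 8 ≠ 1 := by omega
      have h85 : NumberField.discr K % 8 ≠ 5 := by omega
      rw [if_neg h81, if_neg h85]
      refine apply_eq_zero_of_even (m := m) ?_
      have hlt : 2 < 4 * m.natAbs := by have := Int.natAbs_pos.mpr hm0; omega
      have : ((2 : ℕ) : ZMod (4 * m.natAbs)) = 2 := by norm_cast
      rw [← this, ZMod.val_natCast, Nat.mod_eq_of_lt hlt]
      exact even_two

end Quadratic

end Literature.NumberTheory.QuadraticFields
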